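/-
Copyright (c) 2026 the pub-hodgecm-mathlib formalisation cell (harness21).  Prover seat hodgecm-mathlib-LH4-p13 (g8), req620 Track A «(D-RAM) FOUR-FRAME» squad
(STAGE-1b, row (2) of the piece `f_{T₊}`, the (β₂) road; β₂-BOARD v1 da0f832c (LH4-p04 (g8)) row (L-P) «balanced generic cells» (LH7-p09 (g0) SIG-LP v1: «generic: p13 (S-2) ★ +
(S4-disc) ★; c₀-class arithmetic OPEN») — this file is that c₀-CLASS ARITHMETIC in the line-model letters of ★ p861134), 2026-09-04.
-/
import Summits.HodgeConjecture.HodgeConjecture.Theorems.F0P3cDyRamLineValueSetNormRescale   -- ★ p861134 (this seat): `trace_mul_norm_rescale`, `setOf_thicken_traceValue_mul_norm_eq`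
import HarnessLib

/-!
# Crux `H413`, line LH4 «(D-RAM) FOUR-FRAME» — STAGE-1b, row (2), the (β₂) road, (S-2) part iv: «THE c₀-CLASS ARITHMETIC OF THE LINE VALUE SET» — if the two line constants
# satisfy `c′ = c·Θ(w)w·e·(1 + δ)` (`w` a unit stabilising `S`, `e` a `ρ`-fixed unit, `δ` sub-precision) then the thickened value set for `c′` is `e •` the one for `c`

Cell `hodgecm-mathlib` (D-0151), FLOOR 0, crux item H413 = `stmt-HodgeConjecture-24833`, route of record `HCCMUnconditional`; squad F0∕P3c∕LH4; lane
`--supports stmt-HodgeConjecture-24833 --as helper` (count-neutral; pays NO tier-0 row).  THEOREMS ONLY (no `def`, no instance, no notation, no `sorry`, default heartbeats).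
DATUM-FREE algebra over a valued field `M` with ring endomorphisms `ρ` (trace involution, isometric, fixing the thickening scalar) and `Θ`.
WHY.  ★ p861209 (S4-disc, LH4-p04 (g8)): the two literals' line constants `h, h′` sit in opposite norm classes, and on a GENERIC cell `h′ = h·Θ(w)w·e·(1+δ)` holds to the
sub-conductor precision the label needs (`e ∈ F` a unit, `δ` small).  Then, for the thickened trace-value sets `VS(c) := {t ∣ ∃ z ∈ S, |πinv·(t − Tr_ρ(c·q·Θz·z))| ≤ 1}`:
* §1 `setOf_thicken_traceValue_mul_fixed_eq_image` — `VS(c·e) = (e·) '' VS(c)` for a `ρ`-fixed unit `e` (`Tr_ρ(e·x) = e·Tr_ρ(x)`, `|e| = 1`);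
* §2 `setOf_thicken_traceValue_mul_one_add_eq` — `VS(c·(1+δ)) = VS(c)` when `|πinv·(c·δ·q·Θz·z)| ≤ 1` on `S` (`ρ` isometric, `ρ πinv = πinv`; ★ absorption pattern);
* §3 HEAD **`setOf_thicken_traceValue_eq_image_of_classRel`** — `c′ = c·(Θw·w)·e·(1+δ)` with `w ≠ 0`, `w·S ⊆ S`, `w⁻¹·S ⊆ S`, `ρe = e`, `|e| = 1`, the `δ`-bound ⇒ `VS(c′) = (e·) '' VS(c)`
  (★ p861134 ∘ §1 ∘ §2).  So the two literals' plane classes on a generic cell differ EXACTLY by the scaling `e` (whose effect on the census label is ★ p861069 ∕ `ω(e)`).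
HONEST LABEL.  Count-neutral algebra; nothing printed is asserted; no census law is stated; (β₂) stays a HYPOTHESIS; `HC_CM` is proved only modulo the 7 printed citations
(2 remaining named inputs: hLiu418 = `stmt-HodgeConjecture-24832`, h413 = `stmt-HodgeConjecture-24833`) until rung 0 closes.
## References
* [Jacobowitz1962] R. Jacobowitz, *Hermitian forms over local fields*, Amer. J. Math. 84 (1962): §4 (hermitian lines; scaling by norms and by base units).
* [Rogawski1990] J. D. Rogawski, *Automorphic Representations of Unitary Groups in Three Variables*, Ann. of Math. Stud. 123 (1990): §4.9 Prop. 4.9.1 (b) p. 55.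
-/

set_option autoImplicit false

noncomputable section
namespace Summit.HodgeConjecture.HodgeConjecture.Cruxes.H413.F0P3cDyRamLineValueSetClassArith

open scoped Valued WithZero
open Summit.HodgeConjecture.HodgeConjecture.Cruxes.H413.F0P3cDyRamLineValueSetNormRescale

variable {M : Type*} [Field M] [Valued M ℤᵐ⁰]

/-! ## §1 Scaling the line constant by a `ρ`-fixed unit scales the value set -/

/-- **`VS(c·e) = e • VS(c)` FOR A `ρ`-FIXED UNIT `e`**: `Tr_ρ(c·e·X) = e·Tr_ρ(c·X)` and `|πinv·(e·t′ − e·T)| = |πinv·(t′ − T)|`. [cite: Jacobowitz1962, §4] [cite: Rogawski1990, §4.9 Prop. 4.9.1 (b) p. 55] -/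
theorem setOf_thicken_traceValue_mul_fixed_eq_image (ρ Θ : M →+* M) (πinv c q : M) {e : M} (hρe : ρ e = e) (he : Valued.v e = 1) (S : Set M) :
    {t : M | ∃ z ∈ S, Valued.v (πinv * (t - (c * e * q * (Θ z * z) + ρ (c * e * q * (Θ z * z))))) ≤ 1} =
      (fun t => e * t) '' {t : M | ∃ z ∈ S, Valued.v (πinv * (t - (c * q * (Θ z * z) + ρ (c * q * (Θ z * z))))) ≤ 1} := by
  have he0 : e ≠ 0 := fun h => by rw [h, map_zero] at he; exact zero_ne_one he
  have htr : ∀ z : M, c * e * q * (Θ z * z) + ρ (c * e * q * (Θ z * z)) = e * (c * q * (Θ z * z) + ρ (c * q * (Θ z * z))) := fun z => by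
    simp only [map_mul, hρe]; ring
  ext t
  simp only [Set.mem_setOf_eq, Set.mem_image]
  constructor
  · rintro ⟨z, hz, ht⟩
    refine ⟨e⁻¹ * t, ⟨z, hz, ?_⟩, by rw [mul_inv_cancel_left₀ he0]⟩
    rw [htr] at ht
    have e1 : πinv * (e⁻¹ * t - (c * q * (Θ z * z) + ρ (c * q * (Θ z * z)))) = e⁻¹ * (πinv * (t - e * (c * q * (Θ z * z) + ρ (c * q * (Θ z * z))))) := by
      field_simp
    rw [e1, map_mul, map_inv₀, he, inv_one, one_mul]
    exact ht
  · rintro ⟨t', ⟨z, hz, ht'⟩, rfl⟩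
    refine ⟨z, hz, ?_⟩
    rw [htr, ← mul_sub, ← mul_assoc, mul_comm πinv e, mul_assoc, map_mul, he, one_mul]
    exact ht'

/-! ## §2 A sub-precision perturbation of the line constant does not change the value set -/

/-- **`VS(c·(1+δ)) = VS(c)` WHEN `c·δ·q·Θz·z` IS `πinv`-SMALL ON `S`** (`ρ` isometric and fixing `πinv`): `Tr_ρ(c(1+δ)X) = Tr_ρ(cX) + Tr_ρ(cδX)` and the second summand is absorbed.
[cite: Jacobowitz1962, §4] [cite: Rogawski1990, §4.9 Prop. 4.9.1 (b) p. 55] -/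
theorem setOf_thicken_traceValue_mul_one_add_eq (ρ Θ : M →+* M) (hρv : ∀ x, Valued.v (ρ x) = Valued.v x) {πinv : M} (hρπ : ρ πinv = πinv) (c q δ : M)
    (S : Set M) (hδ : ∀ z ∈ S, Valued.v (πinv * (c * δ * q * (Θ z * z))) ≤ 1) :
    {t : M | ∃ z ∈ S, Valued.v (πinv * (t - (c * (1 + δ) * q * (Θ z * z) + ρ (c * (1 + δ) * q * (Θ z * z))))) ≤ 1} =
      {t : M | ∃ z ∈ S, Valued.v (πinv * (t - (c * q * (Θ z * z) + ρ (c * q * (Θ z * z))))) ≤ 1} := by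
  have hsmall : ∀ z ∈ S, Valued.v (πinv * (c * δ * q * (Θ z * z) + ρ (c * δ * q * (Θ z * z)))) ≤ 1 := fun z hz => by
    rw [mul_add]
    refine (Valuation.map_add _ _ _).trans (max_le (hδ z hz) ?_)
    rw [show πinv * ρ (c * δ * q * (Θ z * z)) = ρ (πinv * (c * δ * q * (Θ z * z))) by rw [map_mul ρ πinv, hρπ], hρv]
    exact hδ z hz
  ext t
  simp only [Set.mem_setOf_eq]
  constructor
  · rintro ⟨z, hz, ht⟩
    refine ⟨z, hz, ?_⟩
    have e1 : πinv * (t - (c * q * (Θ z * z) + ρ (c * q * (Θ z * z)))) =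
        πinv * (t - (c * (1 + δ) * q * (Θ z * z) + ρ (c * (1 + δ) * q * (Θ z * z)))) + πinv * (c * δ * q * (Θ z * z) + ρ (c * δ * q * (Θ z * z))) := by
      simp only [map_mul, map_add, map_one]; ring
    rw [e1]
    exact (Valuation.map_add _ _ _).trans (max_le ht (hsmall z hz))
  · rintro ⟨z, hz, ht⟩
    refine ⟨z, hz, ?_⟩
    have e1 : πinv * (t - (c * (1 + δ) * q * (Θ z * z) + ρ (c * (1 + δ) * q * (Θ z * z)))) =
        πinv * (t - (c * q * (Θ z * z) + ρ (c * q * (Θ z * z)))) + -(πinv * (c * δ * q * (Θ z * z) + ρ (c * δ * q * (Θ z * z)))) := by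
      simp only [map_mul, map_add, map_one]; ring
    rw [e1]
    exact (Valuation.map_add _ _ _).trans (max_le ht (by rw [Valuation.map_neg]; exact hsmall z hz))

/-! ## §3 HEAD — the class relation `c′ = c·Θ(w)w·e·(1+δ)` -/

/-- **HEAD — THE c₀-CLASS ARITHMETIC.**  `c′ = c·(Θw·w)·e·(1 + δ)` with `w ≠ 0`, `w·S ⊆ S`, `w⁻¹·S ⊆ S` (a unit stabilising the lattice), `e` a `ρ`-fixed unit, and the perturbation
`πinv`-small on `S` (`|πinv·(c·Θw w·e·δ·q·Θz z)| ≤ 1` for `z ∈ S`; `ρ` isometric, `ρ πinv = πinv`) ⟹ `VS(c′) = (e·) '' VS(c)`.  On a GENERIC (β₂) cell this is the relation between the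
two literals' plane value sets (★ p861209: `h′` vs `h`), so their classes differ exactly by the base-unit scaling `e`. [cite: Jacobowitz1962, §4] [cite: Rogawski1990, §4.9 Prop. 4.9.1 (b) p. 55] -/
theorem setOf_thicken_traceValue_eq_image_of_classRel (ρ Θ : M →+* M) (hρv : ∀ x, Valued.v (ρ x) = Valued.v x) {πinv : M} (hρπ : ρ πinv = πinv)
    (c q : M) {w e δ c' : M} (hw : w ≠ 0) (hρe : ρ e = e) (he : Valued.v e = 1) (hc' : c' = c * (Θ w * w) * e * (1 + δ))
    {S : Set M} (hS : ∀ z ∈ S, w * z ∈ S) (hS' : ∀ z ∈ S, w⁻¹ * z ∈ S)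
    (hδ : ∀ z ∈ S, Valued.v (πinv * (c * (Θ w * w) * e * δ * q * (Θ z * z))) ≤ 1) :
    {t : M | ∃ z ∈ S, Valued.v (πinv * (t - (c' * q * (Θ z * z) + ρ (c' * q * (Θ z * z))))) ≤ 1} =
      (fun t => e * t) '' {t : M | ∃ z ∈ S, Valued.v (πinv * (t - (c * q * (Θ z * z) + ρ (c * q * (Θ z * z))))) ≤ 1} := by
  rw [hc', setOf_thicken_traceValue_mul_one_add_eq ρ Θ hρv hρπ (c * (Θ w * w) * e) q δ S hδ,
    setOf_thicken_traceValue_mul_fixed_eq_image ρ Θ πinv (c * (Θ w * w)) q hρe he S,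
    setOf_thicken_traceValue_mul_norm_eq ρ Θ πinv c q hw hS hS']

end Summit.HodgeConjecture.HodgeConjecture.Cruxes.H413.F0P3cDyRamLineValueSetClassArith

end
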